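import Literature.MathematicalPhysics.QuantumFieldTheory.Balaban1983to89.Node00.Record12BgRowCoClassGaugeRGuardedBRow
import Literature.MathematicalPhysics.QuantumFieldTheory.Balaban1983to89.Node00.Record13SepCoPInhabitedOfThm1CCMWGaugeRAllTorus

/-!
# NODE 00 — ROW P11's BODY OVER `(bd, Dat)` AT A STAGE-13 BACKGROUND ON THE WHOLE TORUS FAMILY: the non-wrapping letter `hsN` DISCHARGED by `PartCompat₁₃` at a cube letter `M = L^a`
# and the guard discharged per prefix — the `(bd, Dat, Ubg)` twin of `Thm/BalabanUVNodesK0AllTorusOfStepTokensGuarded` §1 `bgAtDatumCoP_of_thm1RegSepCoP7MG_of_thm1GaugeG_allTorus`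

Cell `pub-ymgap`, seat `pub-ymgap-k0-s1-w1` g9 (K0⁷ **stmt-QuantumFields-20541** helper lane; (E1)∕(iii-b) WORKPLAN-IIIB 27c850bec22d4efe — sequel of row S1b-3
(`Record12BgRowCoClassGaugeRGuardedBRow` §3); director-ym №338 ∕ №339 (α) ∕ №343 (D1)–(D3): Stage 2 re-points `UbgOfRecord₁₃CoP` to the new `UbgMSCoPOfRecordB …` and runs a coherence
train over `Thm/…K0AllTorusOfStepTokensGuarded(ZB)` — this file puts the train's first Node00-side ingredient in the tree BACKGROUND-GENERICALLY, so the Summits-side re-key is one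
instantiation; FLAG №16 ∕ LOCATE-HSEAM 5d3298b8d191f169; kernel road-scan ROADSCAN-IIIB-g9 53ea8804079dcb1a: `K0AllTorusOfStepTokensGuarded.bgAtDatumCoP_…_allTorus` lies on the K0⁷
body's road).  `--kind proof --supports stmt-QuantumFields-20541` (count-neutral).  THEOREMS ONLY (0 `def`, 0 `sorry`).  [15] = [Balaban1985Variational]; [III] = [Balaban1988Convergent];
[II] = [Balaban1984PropagatorsII]; [I] = [Balaban1987RG1].

HONESTY GUARD (№338 (5)).  PURELY ADDITIVE: print-datum ∕ background parametrisation of `Thm/BalabanUVNodesK0AllTorusOfStepTokensGuarded` §1 (FLAG №16 ∕ LOCATE-HSEAM 5d3298b8d191f169);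
the (b)-instance `bgAtDatumCoP_of_thm1RegSepCoP7MG_of_thm1GaugeG_allTorus` stays landed and true on its own text; nothing there is edited; no displayed premise is deleted or weakened — the
datum, the data row and the background map become parameters `(bd, Dat, Ubg)` with the background's `bd`-spec displayed as the per-prefix dichotomy `hbg` (today's instance ★ below).

WHAT IS PROVED.  ★ `Stage13Params.bgAtDatumBg_of_thm1RegSepCoP7MGB_of_thm1GaugeGB_allTorus` — row P11 at a Stage-13 background `Ubg p n s 𝐖` on EVERY prefix `(p, n, s)` with `n ≤ p.K`, window,
`PartCompat₁₃`, separated `s`, `0 < M₁`, from the guarded `(bd, Dat)` sentences (8) `VariationalThm1RegSepCoP7MGB` (S1a-C) and (9) `VariationalThm1GaugeRegSepCoP7MGB` (S1b-2) whose guard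
`Adm` FOLLOWS from «`1 ≤ n ≤ p.K` ∧ window ∧ `PartCompat₁₃`» (`hAdm`), the numerics letters, the cube letter `θ.τ9.M = L^a` (`hMa`; `hsN` then by `Stage13Params.hsN_of_partCompat₁₃`), and
the background's dichotomy `hbg`; at `n = 0` the window of scales `1 ≤ j ≤ 0` is empty.  ★ `Stage13Params.bgAtDatumCoP_of_thm1RegSepCoP7MGB_of_thm1GaugeGB_allTorus_genSetDatum` — today's
instance (`Ubg := UbgMSCoPOfRecord …`, `bd := genSetDatum F`, `hbg` discharged by `ubgMSCoPOfRecord_dichotomy_genSetDatum`, any `Dat`; the Summits §1 is its `Dat := dataSmall7PTopOf` instance).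
HONEST SCOPE.  Hypothesis threading; nothing of [15] ∕ [III] asserted or discharged; `stub_prop8StepCoPGridG13` ∕ K0⁷ NOT closed; N07 NOT discharged; counts unmoved (typed 28∕28 ·
discharged 8∕28); one finite `𝕋⁴` family at fixed `ε` — the route closes the conditional finite-𝕋⁴ rung `BalabanLadder.UV` only; NOT continuum ∕ ℝ⁴ ∕ OS; the Yang–Mills mass gap (Clay)
is NOT proved by any of this.  No `def`, no `instance`, no `notation`, no `sorry`.

References: [15] (6)–(7) p.278, Thm 1 (8)–(9) p.279, Prop. 8 p.304, p.304 lines 1–2; [III] Thm 1 p.262, (2.1) p.254, (2.4)–(2.8) pp.255–256, (2.12)–(2.13) p.256, (2.27)–(2.28)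
p.259, (2.34)–(2.41) p.261; [II] (2.3) p.224; [I] (0.1) p.251, (1.11)–(1.12) p.262.
-/

noncomputable section

open MeasureTheory
open scoped Matrix.Norms.L2Operator

namespace Literature.MathematicalPhysics.QuantumFieldTheory.Balaban1983to89.Node00

open T4Continuum B14.Eq218Concrete B15DeterminingSets B15DeterminingSetsB B12RegularSpaces111 B14RegularSpaces234 B14Radii

variable {F : T4Family} {N : ℕ} [NeZero N]

/-- **★ ROW P11 (`BgProvisoΛ` content: `U_k ∈ U^c_j` and `∈ Ũ^c_j`) FOR A STAGE-13 BACKGROUND `Ubg p n s 𝐖` ON EVERY PREFIX `(p, n, s)` (`n ≤ p.K`, window, `PartCompat₁₃`, separated `s`,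
`0 < M₁`), FROM THE GUARDED `(bd, Dat)` SENTENCES (8) `VariationalThm1RegSepCoP7MGB … Adm bd Dat …` AND (9) `VariationalThm1GaugeRegSepCoP7MGB … θ.τ9.M Adm bd Dat …` WHOSE GUARD FOLLOWS
FROM «`1 ≤ n ≤ p.K` ∧ window ∧ `PartCompat₁₃`» (`hAdm`), the numerics letters, the cube letter `θ.τ9.M = L^a` (`hMa`), and the background's `bd`-spec dichotomy `hbg`** — the
`(bd, Dat, Ubg)` twin of `Thm/…K0AllTorusOfStepTokensGuarded.bgAtDatumCoP_of_thm1RegSepCoP7MG_of_thm1GaugeG_allTorus`: `Record12BgRowCoClassGaugeRGuardedBRow` §3 with `hsN` DISCHARGED on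
the whole torus family by `Stage13Params.hsN_of_partCompat₁₃` and the guard by `hAdm`; at `n = 0` the window of scales is empty.  CONDITIONAL on the two `Prop`s (hypotheses here);
nothing of Bałaban asserted. [cite: Balaban1985Variational, Thm 1 (8)–(9) p.279, Prop. 8 p.304, p.304 lines 1–2; Balaban1988Convergent, Thm 1 p.262, (2.1) p.254, (2.5) p.255, p.257, (2.12)–(2.13) p.256, (2.27)–(2.28) p.259, (2.34)–(2.41) p.261; Balaban1984PropagatorsII, (2.3) p.224; Balaban1987RG1, (0.1) p.251, (1.12) p.262] -/
theorem Stage13Params.bgAtDatumBg_of_thm1RegSepCoP7MGB_of_thm1GaugeGB_allTorus (θ : Stage13Params F N) (hθ : θ.Admissible F N) (hRz : θ.Rz = RzOfRecord F N)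
    {Adm : StepGuard F} {bd : BondDatum F} {Dat : TopData F N} {B₃ B₃' a₀ a₁ : ℝ} (hM : 0 < θ.τ9.M)
    (h15 : VariationalThm1RegSepCoP7MGB F N Adm bd Dat B₃ a₀ a₁) (h15G : VariationalThm1GaugeRegSepCoP7MGB F N θ.τ9.M Adm bd Dat B₃ B₃' a₀ a₁)
    (Ubg : (p : B12.RunParams) → (n : ℕ) → SeqOfRecord F θ.ν θ.τ9.M (gOfRecord₁₃ F N θ p) p.K n → MSField (F.P p.K) (SU N) → GaugeField (F.P p.K) 0 (SU N))
    (hbg : ∀ (p : B12.RunParams) (n : ℕ) (s : SeqOfRecord F θ.ν θ.τ9.M (gOfRecord₁₃ F N θ p) p.K n) (W : MSField (F.P p.K) (SU N)),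
      IsMinimizerB (avOfRecord F N p.K) (regMSCoPOfRecord F N θ.ν p.K n s.Ω) (bd p.K n s.Ω) W (Ubg p n s W) ∨ Ubg p n s W = 1)
    (hnum : ∀ (p : B12.RunParams) (n : ℕ), n ≤ p.K → Step.InInterval θ.γ n (gOfRecord₁₃ F N θ p) → ∀ m, m ≤ n →
      0 < θ.s2.cR * epsOfRecord θ.ν (gOfRecord₁₃ F N θ p) m ∧ θ.s2.cR * epsOfRecord θ.ν (gOfRecord₁₃ F N θ p) m ≤ a₁ ∧ B₃ * (θ.s2.cR * epsOfRecord θ.ν (gOfRecord₁₃ F N θ p) m) ≤ θ.ν.εreg)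
    (ha₀ : θ.ν.εreg ≤ a₀)
    (hcomp : ∀ (p : B12.RunParams) (n : ℕ), n ≤ p.K → Step.InInterval θ.γ n (gOfRecord₁₃ F N θ p) → ∀ m, m < n →
      θ.s2.cR * epsOfRecord θ.ν (gOfRecord₁₃ F N θ p) m ≤ 2 * (θ.s2.cR * epsOfRecord θ.ν (gOfRecord₁₃ F N θ p) (m + 1)))
    (hcomp' : ∀ (p : B12.RunParams) (n : ℕ), n ≤ p.K → Step.InInterval θ.γ n (gOfRecord₁₃ F N θ p) → ∀ m, m < n →
      θ.s2.cR * epsOfRecord θ.ν (gOfRecord₁₃ F N θ p) (m + 1) ≤ 2 * (θ.s2.cR * epsOfRecord θ.ν (gOfRecord₁₃ F N θ p) m))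
    (hBα : ∀ (p : B12.RunParams) (n : ℕ), n ≤ p.K → Step.InInterval θ.γ n (gOfRecord₁₃ F N θ p) → ∀ m, 1 ≤ m → m ≤ n →
      B₃ * (θ.s2.cR * epsOfRecord θ.ν (gOfRecord₁₃ F N θ p) m) ≤ (1 - θ.s2.βc) * (lfOfRecord₁₂ F N θ.toStage12Params).alpha0 (gOfRecord₁₃ F N θ p m))
    (htI : ∀ (p : B12.RunParams) (n : ℕ), n ≤ p.K → Step.InInterval θ.γ n (gOfRecord₁₃ F N θ p) → ∀ m, 1 ≤ m → m ≤ n →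
      B₃' * (θ.s2.cR * epsOfRecord θ.ν (gOfRecord₁₃ F N θ p) m) ≤ θ.s2.cB * (lfOfRecord₁₂ F N θ.toStage12Params).alpha0 (gOfRecord₁₃ F N θ p m))
    (htMS : ∀ (p : B12.RunParams) (n : ℕ), n ≤ p.K → Step.InInterval θ.γ n (gOfRecord₁₃ F N θ p) → ∀ m, 1 ≤ m → m ≤ n →
      B₃' * (θ.s2.cR * epsOfRecord θ.ν (gOfRecord₁₃ F N θ p) m) ≤ θ.s2.B * θ.s2.C * θ.s2.Mr * (lfOfRecord₁₂ F N θ.toStage12Params).alpha0 (gOfRecord₁₃ F N θ p m))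
    (hC1 : ∀ (p : B12.RunParams) (n : ℕ), n ≤ p.K → Step.InInterval θ.γ n (gOfRecord₁₃ F N θ p) → ∀ j, 1 ≤ j → j ≤ n →
      ∃ t : ℕ, 0 < t ∧ RkOfRecord (F.P p.K).L θ.ν.r (gOfRecord₁₃ F N θ p j) = (F.P p.K).L * t)
    (hMa : ∃ a : ℕ, θ.τ9.M = F.L ^ a)
    (hAdm : ∀ (p : B12.RunParams) (n : ℕ) (s : SeqOfRecord F θ.ν θ.τ9.M (gOfRecord₁₃ F N θ p) p.K n), 1 ≤ n → n ≤ p.K →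
      Step.InInterval θ.γ n (gOfRecord₁₃ F N θ p) → PartCompat₁₃ F N θ p n → Adm θ.ν θ.τ9.M (gOfRecord₁₃ F N θ p) p.K n s) :
    ∀ (p : B12.RunParams) (n : ℕ), n ≤ p.K → Step.InInterval θ.γ n (gOfRecord₁₃ F N θ p) → PartCompat₁₃ F N θ p n →
      ∀ s : SeqOfRecord F θ.ν θ.τ9.M (gOfRecord₁₃ F N θ p) p.K n, Sect2.SeqSeparated θ.ν.M₁ s → 0 < θ.ν.M₁ → ∀ W : MSField (F.P p.K) (SU N),
      Dat p.K s.Ω (suppDomOfRecord F θ.ν p.K s.Ω) n (fun j => θ.s2.cR * epsOfRecord θ.ν (gOfRecord₁₃ F N θ p) j) W →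
      ∀ j, 1 ≤ j → j ≤ n → ∀ X : (Sect2.domSys (F.P p.K) θ.τ9.M j).Dom,
      (Sect2.domSites (F.P p.K) θ.τ9.M j X ⊆ s.Λ j →
        Sect2.ofBackgroundC (settingOfRecord₁₃ F N θ p).ι (Ubg p n s W) ∈
          Sect2.spaceI (settingOfRecord₁₃ F N θ p) (θ.Rz p.K) θ.τ9.M j (Sect2.domSites (F.P p.K) θ.τ9.M j X)
            ((settingOfRecord₁₃ F N θ p).lf.alpha0 ((settingOfRecord₁₃ F N θ p).flow.g j)) ((settingOfRecord₁₃ F N θ p).lf.alpha1 ((settingOfRecord₁₃ F N θ p).flow.g j))) ∧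
      (Sect2.admB (F.P p.K) θ.ν θ.τ9.M (gOfRecord₁₃ F N θ p) s.Ω s.Λ j (Sect2.domSites (F.P p.K) θ.τ9.M j X) = true →
        Sect2.ofBackgroundC (settingOfRecord₁₃ F N θ p).ι (Ubg p n s W) ∈
          Sect2.spaceMS (settingOfRecord₁₃ F N θ p) (θ.Rz p.K) θ.τ9.M j (Sect2.domSites (F.P p.K) θ.τ9.M j X) s.Ω) := by
  intro p n hn hw hpc s hsep hM₁ W h7
  obtain ⟨a, ha⟩ := hMa
  rcases Nat.eq_zero_or_pos n with rfl | hn1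
  · intro j h1 hj; exfalso; omega
  · rw [hRz]
    exact bgRowAtDatumBg_of_thm1RegSepCoP7MGB_of_thm1GaugeGB h15 h15G (settingOfRecord₁₃ F N θ p) rfl rfl (settingOfRecord₁₃_laws F N θ p)
      (settingOfRecord₁₃_pos F N θ hθ.1.pos p) θ.ν hM p.K n θ.s2.cR (hnum p n hn hw) ha₀ (hcomp p n hn hw) (hcomp' p n hn hw)
      (fun m _ hm => alphaPos₁₃_of_inInterval hθ hw hm) (hBα p n hn hw) (htI p n hn hw) (htMS p n hn hw) (hC1 p n hn hw) hpc
      (θ.hsN_of_partCompat₁₃ ha hn1 hpc (hC1 p n hn hw)) s hsep hM₁ (hAdm p n s hn1 hn hw hpc) W h7 _ (hbg p n s W)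

/-- ★ **TODAY's INSTANCE ON THE WHOLE TORUS FAMILY**: node00-def-R's `UbgMSCoPOfRecord … n s 𝐖` at reading (b)'s datum `genSetDatum F`, `hbg` discharged (`ubgMSCoPOfRecord_dichotomy_genSetDatum`),
any data predicate `Dat` (`Thm/…K0AllTorusOfStepTokensGuarded` §1 is its `Dat := dataSmall7PTopOf F N` instance). [cite: Balaban1985Variational, Thm 1 (8)–(9) p.279, Prop. 8 p.304; Balaban1988Convergent, Thm 1 p.262, (2.1) p.254, (2.12)–(2.13) p.256, (2.27)–(2.28) p.259, (2.34)–(2.41) p.261; Balaban1987RG1, (0.1) p.251, (1.12) p.262] -/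
theorem Stage13Params.bgAtDatumCoP_of_thm1RegSepCoP7MGB_of_thm1GaugeGB_allTorus_genSetDatum (θ : Stage13Params F N) (hθ : θ.Admissible F N) (hRz : θ.Rz = RzOfRecord F N)
    {Adm : StepGuard F} {Dat : TopData F N} {B₃ B₃' a₀ a₁ : ℝ} (hM : 0 < θ.τ9.M)
    (h15 : VariationalThm1RegSepCoP7MGB F N Adm (genSetDatum F) Dat B₃ a₀ a₁) (h15G : VariationalThm1GaugeRegSepCoP7MGB F N θ.τ9.M Adm (genSetDatum F) Dat B₃ B₃' a₀ a₁)
    (hnum : ∀ (p : B12.RunParams) (n : ℕ), n ≤ p.K → Step.InInterval θ.γ n (gOfRecord₁₃ F N θ p) → ∀ m, m ≤ n →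
      0 < θ.s2.cR * epsOfRecord θ.ν (gOfRecord₁₃ F N θ p) m ∧ θ.s2.cR * epsOfRecord θ.ν (gOfRecord₁₃ F N θ p) m ≤ a₁ ∧ B₃ * (θ.s2.cR * epsOfRecord θ.ν (gOfRecord₁₃ F N θ p) m) ≤ θ.ν.εreg)
    (ha₀ : θ.ν.εreg ≤ a₀)
    (hcomp : ∀ (p : B12.RunParams) (n : ℕ), n ≤ p.K → Step.InInterval θ.γ n (gOfRecord₁₃ F N θ p) → ∀ m, m < n →
      θ.s2.cR * epsOfRecord θ.ν (gOfRecord₁₃ F N θ p) m ≤ 2 * (θ.s2.cR * epsOfRecord θ.ν (gOfRecord₁₃ F N θ p) (m + 1)))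
    (hcomp' : ∀ (p : B12.RunParams) (n : ℕ), n ≤ p.K → Step.InInterval θ.γ n (gOfRecord₁₃ F N θ p) → ∀ m, m < n →
      θ.s2.cR * epsOfRecord θ.ν (gOfRecord₁₃ F N θ p) (m + 1) ≤ 2 * (θ.s2.cR * epsOfRecord θ.ν (gOfRecord₁₃ F N θ p) m))
    (hBα : ∀ (p : B12.RunParams) (n : ℕ), n ≤ p.K → Step.InInterval θ.γ n (gOfRecord₁₃ F N θ p) → ∀ m, 1 ≤ m → m ≤ n →
      B₃ * (θ.s2.cR * epsOfRecord θ.ν (gOfRecord₁₃ F N θ p) m) ≤ (1 - θ.s2.βc) * (lfOfRecord₁₂ F N θ.toStage12Params).alpha0 (gOfRecord₁₃ F N θ p m))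
    (htI : ∀ (p : B12.RunParams) (n : ℕ), n ≤ p.K → Step.InInterval θ.γ n (gOfRecord₁₃ F N θ p) → ∀ m, 1 ≤ m → m ≤ n →
      B₃' * (θ.s2.cR * epsOfRecord θ.ν (gOfRecord₁₃ F N θ p) m) ≤ θ.s2.cB * (lfOfRecord₁₂ F N θ.toStage12Params).alpha0 (gOfRecord₁₃ F N θ p m))
    (htMS : ∀ (p : B12.RunParams) (n : ℕ), n ≤ p.K → Step.InInterval θ.γ n (gOfRecord₁₃ F N θ p) → ∀ m, 1 ≤ m → m ≤ n →
      B₃' * (θ.s2.cR * epsOfRecord θ.ν (gOfRecord₁₃ F N θ p) m) ≤ θ.s2.B * θ.s2.C * θ.s2.Mr * (lfOfRecord₁₂ F N θ.toStage12Params).alpha0 (gOfRecord₁₃ F N θ p m))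
    (hC1 : ∀ (p : B12.RunParams) (n : ℕ), n ≤ p.K → Step.InInterval θ.γ n (gOfRecord₁₃ F N θ p) → ∀ j, 1 ≤ j → j ≤ n →
      ∃ t : ℕ, 0 < t ∧ RkOfRecord (F.P p.K).L θ.ν.r (gOfRecord₁₃ F N θ p j) = (F.P p.K).L * t)
    (hMa : ∃ a : ℕ, θ.τ9.M = F.L ^ a)
    (hAdm : ∀ (p : B12.RunParams) (n : ℕ) (s : SeqOfRecord F θ.ν θ.τ9.M (gOfRecord₁₃ F N θ p) p.K n), 1 ≤ n → n ≤ p.K →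
      Step.InInterval θ.γ n (gOfRecord₁₃ F N θ p) → PartCompat₁₃ F N θ p n → Adm θ.ν θ.τ9.M (gOfRecord₁₃ F N θ p) p.K n s) :
    ∀ (p : B12.RunParams) (n : ℕ), n ≤ p.K → Step.InInterval θ.γ n (gOfRecord₁₃ F N θ p) → PartCompat₁₃ F N θ p n →
      ∀ s : SeqOfRecord F θ.ν θ.τ9.M (gOfRecord₁₃ F N θ p) p.K n, Sect2.SeqSeparated θ.ν.M₁ s → 0 < θ.ν.M₁ → ∀ W : MSField (F.P p.K) (SU N),
      Dat p.K s.Ω (suppDomOfRecord F θ.ν p.K s.Ω) n (fun j => θ.s2.cR * epsOfRecord θ.ν (gOfRecord₁₃ F N θ p) j) W →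
      ∀ j, 1 ≤ j → j ≤ n → ∀ X : (Sect2.domSys (F.P p.K) θ.τ9.M j).Dom,
      (Sect2.domSites (F.P p.K) θ.τ9.M j X ⊆ s.Λ j →
        Sect2.ofBackgroundC (settingOfRecord₁₃ F N θ p).ι (UbgMSCoPOfRecord F N θ.ν θ.τ9.M (gOfRecord₁₃ F N θ p) p.K n s W) ∈
          Sect2.spaceI (settingOfRecord₁₃ F N θ p) (θ.Rz p.K) θ.τ9.M j (Sect2.domSites (F.P p.K) θ.τ9.M j X)
            ((settingOfRecord₁₃ F N θ p).lf.alpha0 ((settingOfRecord₁₃ F N θ p).flow.g j)) ((settingOfRecord₁₃ F N θ p).lf.alpha1 ((settingOfRecord₁₃ F N θ p).flow.g j))) ∧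
      (Sect2.admB (F.P p.K) θ.ν θ.τ9.M (gOfRecord₁₃ F N θ p) s.Ω s.Λ j (Sect2.domSites (F.P p.K) θ.τ9.M j X) = true →
        Sect2.ofBackgroundC (settingOfRecord₁₃ F N θ p).ι (UbgMSCoPOfRecord F N θ.ν θ.τ9.M (gOfRecord₁₃ F N θ p) p.K n s W) ∈
          Sect2.spaceMS (settingOfRecord₁₃ F N θ p) (θ.Rz p.K) θ.τ9.M j (Sect2.domSites (F.P p.K) θ.τ9.M j X) s.Ω) :=
  Stage13Params.bgAtDatumBg_of_thm1RegSepCoP7MGB_of_thm1GaugeGB_allTorus θ hθ hRz hM h15 h15G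
    (fun p n s W => UbgMSCoPOfRecord F N θ.ν θ.τ9.M (gOfRecord₁₃ F N θ p) p.K n s W)
    (fun p n s W => ubgMSCoPOfRecord_dichotomy_genSetDatum θ.ν θ.τ9.M (gOfRecord₁₃ F N θ p) p.K n s W) hnum ha₀ hcomp hcomp' hBα htI htMS hC1 hMa hAdm

end Literature.MathematicalPhysics.QuantumFieldTheory.Balaban1983to89.Node00

end
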